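import Summits.QuantumFields.BalabanUV.Beta.SecondOrderClassStep
import Summits.QuantumFields.BalabanUV.Beta.SpineRecursivePureParity

/-!
# `BalabanUV.Beta.SecondOrderClassLiteral` — binder row D1, the W-side (L4) of hR, leaf (W-CLASS-Q), part 5: THE CLASS INDUCTION AT THE
# LITERAL — the displayed second symbol `X2s` and residual `Δ` of leaf-10's `SecondOrderSplitLiteral.W2OfK_sharp_split_literal₂` are
# separation-localised (and `Δ` parity-odd) from the letter classes and the level-`j` class of `R2 j α`; hence the owner's remainder recursion
# `hR2succ` (`SpineRecursiveT2All` p216525) PRESERVES the class «`LocStencil₂` + row-parity-odd», and the class holds at every level from level 0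
# (β sub-cell, D1 formalisation swarm seat `b2b-balaban-beta-d1-formalise-leaf-05`, gen 5; row HR-W-CLASS-Q, typer-g4 l.11945)

HONEST FRAMING (cell contract, verbatim): «discharging `BetaPertH` makes Bałaban's UV stability UNCONDITIONAL — a real
constructive-QFT result; it is NOT the continuum limit and NOT the Clay problem.»  HONEST DEPENDENCY (verbatim): «continuum YM on T⁴ ⇐
BetaPertH ∧ nine spine estimates (0/9 proved); BetaPertH ⇐ (D1) ∧ (D4) ∧ CAP+tail; G-an2-4 gates asym, D1 and NE2/3/4.»  [folklore]
analysis∕parity bookkeeping; no statement of Bałaban's papers, no `[cite:]` tag, no `def`, no `Prop` fact; instantiates NO binder of the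
β-function wall; NOT D1, NOT `BetaPertH`, NOT continuum, NOT Clay.  ABSOLUTE RULE (cell, verbatim): «No internally-minted statement may enter
as a cited fact. Every hypothesis is either kernel-proved in this package or a verbatim quotation of a PUBLISHED theorem with page reference. The
manuscript(s) under audit are NOT citable for their own disputed steps — they are the thing under adjudication; programme-internal
(2001/route/tribunal) claims are never citable.»  Nothing is cited here.

## What is proved (generic `d`, in-block root `toSite r`, `Lc ≥ 1`, any `cE cVH cΛ`, any `γ : ℕ → ℝ`, any coefficients `a w : ℝ`)

* §1 **`sep_X2s_literal`**: the displayed second symbol's diagonal kernels `diagK (X2s j α b c)` are separation-localised, from the letter class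
  `∃ Ch mh, LocStencil₂ (κuκ′u′ ↦ diagK (h κuκ′u′)) Ch mh` alone (`diagK_add'`, `diagK_dressed₂_eq_vertex2OfK`, `diagK_dressed_eq_vertexOfK`,
  part 3's `sep_vertex2OfK` ∕ `sep_vertexOfK_diag_of_vertexFamily` ∕ `vertexFamily_K2OfK_add_Xi` at the literal suppliers).
* §2 **`sep_Delta_literal₂`** ∕ **`parityOdd_Delta_literal₂`**: the displayed residual
  `Δ b c = dM (Ξ_j α c) Lc (SpureRecAt j) (M1At j) b + (vertex2OfK G_j Lc R2 b c + (mixOfK G_j Lc RM b c + mixOfK G_j Lc RM c b))` is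
  separation-localised and row-parity-odd, from `∃ C δ, LocStencil₂ R2 C δ` + rows of `R2` parity-odd (the induction hypothesis) and
  `∃ C δ, LocStencilFM Lc RM C δ` + rows of `RM` parity-odd (the mixed letter's remainder class).
* §3 **`locStencil₂_R2succ_literal`** ∕ **`parityOdd_R2succ_literal`**: THE CLASS STEP — the owner's `hR2succ` right-hand side at the literal
  is `LocStencil₂` (some rate) with parity-odd rows, from the classes of `h j α` (this level's symbol), `h′` (next level's symbol), `RB` (the
  border letter's remainder: class + parity), `R2` (this level: class + parity), `RM` (class + parity).
Provenance: b2b-balaban β sub-cell, D1 formalisation swarm leaf-05 gen 5, 2026-08-20 (v1); no existing file touched.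
-/

noncomputable section

open Finset
open scoped BigOperators
open Literature.MathematicalPhysics.QuantumFieldTheory
open Literature.MathematicalPhysics.QuantumFieldTheory.Balaban1983to89
open Literature.MathematicalPhysics.QuantumFieldTheory.Balaban1983to89.Beta
open B12Sec2to5 (l1 l1_nonneg)
open ExpKernelCalculus (MKer Site Decays BiLoc VertexFamily comp)
open AffineAveraging (box toSite)
open OneStepResolventKernel (Fib LocStencil)
open OneStepKernelFamily (KInvStep colH vertexOfK)
open BalabanStepJetsSucc (mmRead)
open BalabanCompositeJets (LocStencil₂)
open SecondOrderResponse (dM K2OfK vertex2OfK mixOfK LocStencilFM)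
open Summit.QuantumFields.BalabanUV.Beta.TameKernelCalculus
open Summit.QuantumFields.BalabanUV.Beta.ChartConjugation (conjV)
open Summit.QuantumFields.BalabanUV.Beta.BorderedHessian (sgnK diagK ctGen bhKStepAt spr_bhKStepAt)
open Summit.QuantumFields.BalabanUV.Beta.BubbleParity (trK_coDressKBmAt_KInvStep)
open Summit.QuantumFields.BalabanUV.Beta.AxialDressingRooted (coDressKBmAt decays_coDressKBmAt_KInvStep)
open Summit.QuantumFields.BalabanUV.Beta.WardLocusCubic (mmSym)
open Summit.QuantumFields.BalabanUV.Beta.KernelWardRemainderParity (parityOdd_add)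
open Summit.QuantumFields.BalabanUV.Beta.SpineRooted (SpureRecAt M1At locStencil_SpureRecAt vertexFamily_M1At)
open Summit.QuantumFields.BalabanUV.Beta.SpineRecursivePureParity (parityOdd_dM_SpureRecAt_M1At locStencil_diagK_smul_ctGen)
open Summit.QuantumFields.BalabanUV.Beta.SecondOrderRemainderTables (parityOdd_slot₂)
open Summit.QuantumFields.BalabanUV.Beta.SecondOrderSplitDecay (diagK_dressed_eq_vertexOfK)
open Summit.QuantumFields.BalabanUV.Beta.SecondOrderSplitLoc (diagK_add' diagK_dressed₂_eq_vertex2OfK)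
open Summit.QuantumFields.BalabanUV.Beta.SecondOrderSeparationCalculus (sep_add sep_vertex2OfK sep_mixOfK sep_mixOfK_swap
  sep_dM_of_vertexFamily sep_vertexOfK_diag_of_vertexFamily vertexFamily_Xi vertexFamily_K2OfK_add_Xi)
open Summit.QuantumFields.BalabanUV.Beta.SecondOrderClassStep (locStencil₂_R2succ parityOdd_R2succ)

namespace Summit.QuantumFields.BalabanUV.Beta.SecondOrderClassLiteral

variable {d : ℕ} {Lc : ℕ} [NeZero Lc]

/-! ## §0 The literal suppliers in the shapes the calculus wants -/

section Suppliers

/-- [folklore] `G_j` decays (Literature shape `∃ δ C, 0 < δ ∧ 0 ≤ C ∧ Decays …`). -/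
theorem decays_G {r : Fin (d + 1) → ℕ} (hr : r ∈ box (d + 1) Lc) (j : ℕ) :
    ∃ δ C : ℝ, 0 < δ ∧ 0 ≤ C ∧ Decays (coDressKBmAt (toSite r) Lc (KInvStep (d := d) Lc j)) C δ :=
  decays_coDressKBmAt_KInvStep (d := d) hr j

/-- [folklore] `𝕄_j = bhKStepAt d (toSite r) Lc j` decays, in the same shape. -/
theorem decays_M {r : Fin (d + 1) → ℕ} (hr : r ∈ box (d + 1) Lc) (j : ℕ) :
    ∃ δ C : ℝ, 0 < δ ∧ 0 ≤ C ∧ Decays (bhKStepAt d (toSite r) Lc j) C δ :=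
  locStencil₂_R2succ.spr_bhKStepAt_pkg (d := d) hr j

/-- [folklore] The generator family `κ u ↦ diagK (γ_j·ctGen d α Lc κ u)` is a local stencil family (some rate). -/
theorem locStencil_gen (c : ℝ) (α : Fin (d + 1)) :
    ∃ Cg δg : ℝ, 0 < δg ∧ LocStencil (fun κ u => diagK fun p a => c * ctGen d α Lc κ u p a) Cg δg :=
  ⟨_, 1, one_pos, locStencil_diagK_smul_ctGen (Lc := Lc) c α zero_le_one⟩

omit [NeZero Lc] in
/-- [folklore] `M1At … j` is a vertex family (some rate). -/
theorem vertexFamily_M1At_pkg (hLc : 1 ≤ Lc) {r : Fin (d + 1) → ℕ} (hr : r ∈ box (d + 1) Lc) (cΛ : ℝ) (j : ℕ) :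
    ∃ CM δM : ℝ, 0 < δM ∧ VertexFamily (M1At d Lc (toSite r) cΛ j) Lc CM δM :=
  ⟨_, 1, one_pos, vertexFamily_M1At hLc hr cΛ j zero_le_one⟩

end Suppliers

/-! ## §1 The displayed second symbol is separation-localised -/

section X2s

/-- [folklore] **THE DISPLAYED SECOND SYMBOL OF `W2OfK_sharp_split_literal(₂)` IS SEPARATION-LOCALISED**: for every bond pair `(b, c) = ((μ,y),(ν,y′))`
the diagonal kernel of `X2s j α b c = (Σ colH G_j b · Σ colH G_j c · h) + Σ colH (K2OfK … c + Ξ_j α c) b · (γ_j·ctGen)` is bi-localised at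
`(Lc•y, Lc•y)` with a constant decaying in `|Lc•y − Lc•y′|`, uniformly in the bonds — from the letter class of `h` alone. -/
theorem sep_X2s_literal (hLc : 1 ≤ Lc) {r : Fin (d + 1) → ℕ} (hr : r ∈ box (d + 1) Lc) (cE cVH cΛ : ℝ) (γ : ℕ → ℝ) (j : ℕ)
    (α : Fin (d + 1)) {h : Fin (d + 1) → (Fin (d + 1) → ℤ) → Fin (d + 1) → (Fin (d + 1) → ℤ) → (Fin (d + 1) → ℤ) → Fib d → ℝ}
    (hhl : ∃ Ch mh : ℝ, 0 < mh ∧ LocStencil₂ (fun κ u κ' u' => diagK (h κ u κ' u')) Ch mh) :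
    ∃ C δ : ℝ, 0 < δ ∧ ∀ μ y ν y', BiLoc (diagK fun p c =>
        (∑ κ, ∑' u, colH (coDressKBmAt (toSite r) Lc (KInvStep (d := d) Lc j)) Lc μ y κ u *
            ∑ κ', ∑' u', colH (coDressKBmAt (toSite r) Lc (KInvStep (d := d) Lc j)) Lc ν y' κ' u' * h κ u κ' u' p c) +
          ∑ κ, ∑' u, colH (K2OfK (coDressKBmAt (toSite r) Lc (KInvStep (d := d) Lc j)) Lc (SpureRecAt d Lc (toSite r) cE cVH cΛ j)
              (M1At d Lc (toSite r) cΛ j) ν y' +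
            (-(comp (comp (coDressKBmAt (toSite r) Lc (KInvStep (d := d) Lc j))
                (conjV (bhKStepAt d (toSite r) Lc j)
                  (diagK fun p c => ∑ κ, ∑' u, colH (coDressKBmAt (toSite r) Lc (KInvStep (d := d) Lc j)) Lc ν y' κ u * (γ j * ctGen d α Lc κ u p c))))
                (coDressKBmAt (toSite r) Lc (KInvStep (d := d) Lc j))))) Lc μ y κ u * (γ j * ctGen d α Lc κ u p c))
      ((Lc : ℤ) • y) ((Lc : ℤ) • y) (C * Real.exp (-δ * l1 ((Lc : ℤ) • y - (Lc : ℤ) • y'))) δ := by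
  have hK := decays_G (d := d) hr j
  obtain ⟨C, δ, hδ, hsum⟩ := sep_add (N := Lc)
    (sep_vertex2OfK (N := Lc) hK hhl)
    (sep_vertexOfK_diag_of_vertexFamily (N := Lc)
      (vertexFamily_K2OfK_add_Xi (N := Lc) hK (decays_M hr j) (locStencil_SpureRecAt hLc hr cE cVH cΛ j) (vertexFamily_M1At_pkg hLc hr cΛ j)
        (locStencil_gen (Lc := Lc) (γ j) α))
      (locStencil_gen (Lc := Lc) (γ j) α))
  refine ⟨C, δ, hδ, fun μ y ν y' => ?_⟩
  rw [diagK_add', diagK_dressed₂_eq_vertex2OfK, diagK_dressed_eq_vertexOfK]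
  exact hsum μ y ν y'

end X2s

/-! ## §2 The displayed residual is separation-localised and parity-odd -/

section Delta

/-- [folklore] **THE DISPLAYED RESIDUAL `Δ` (TWO REMAINDER SLOTS) IS SEPARATION-LOCALISED**, from the classes of `R2` (induction hypothesis) and
`RM` (the mixed letter's remainder) at SOME rates; the contact kernel `Ξ_j α c` enters through part 3's `vertexFamily_Xi`. -/
theorem sep_Delta_literal₂ (hLc : 1 ≤ Lc) {r : Fin (d + 1) → ℕ} (hr : r ∈ box (d + 1) Lc) (cE cVH cΛ : ℝ) (γ : ℕ → ℝ) (j : ℕ)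
    (α : Fin (d + 1)) {R2 RM : Fin (d + 1) → (Fin (d + 1) → ℤ) → Fin (d + 1) → (Fin (d + 1) → ℤ) → MKer (d + 1) (Fib d)}
    (hR2 : ∃ C δ : ℝ, 0 < δ ∧ LocStencil₂ R2 C δ) (hRM : ∃ C δ : ℝ, 0 < δ ∧ LocStencilFM Lc RM C δ) :
    ∃ C δ : ℝ, 0 < δ ∧ ∀ μ y ν y', BiLoc
      (dM (-(comp (comp (coDressKBmAt (toSite r) Lc (KInvStep (d := d) Lc j))
              (conjV (bhKStepAt d (toSite r) Lc j)
                (diagK fun p c => ∑ κ, ∑' u, colH (coDressKBmAt (toSite r) Lc (KInvStep (d := d) Lc j)) Lc ν y' κ u * (γ j * ctGen d α Lc κ u p c))))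
              (coDressKBmAt (toSite r) Lc (KInvStep (d := d) Lc j))))
          Lc (SpureRecAt d Lc (toSite r) cE cVH cΛ j) (M1At d Lc (toSite r) cΛ j) μ y +
        (vertex2OfK (coDressKBmAt (toSite r) Lc (KInvStep (d := d) Lc j)) Lc R2 μ y ν y' +
          (mixOfK (coDressKBmAt (toSite r) Lc (KInvStep (d := d) Lc j)) Lc RM μ y ν y' +
            mixOfK (coDressKBmAt (toSite r) Lc (KInvStep (d := d) Lc j)) Lc RM ν y' μ y)))
      ((Lc : ℤ) • y) ((Lc : ℤ) • y) (C * Real.exp (-δ * l1 ((Lc : ℤ) • y - (Lc : ℤ) • y'))) δ := by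
  have hK := decays_G (d := d) hr j
  exact sep_add (N := Lc)
    (sep_dM_of_vertexFamily (N := Lc)
      (vertexFamily_Xi (N := Lc) hK (decays_M hr j) (locStencil_gen (Lc := Lc) (γ j) α))
      (locStencil_SpureRecAt hLc hr cE cVH cΛ j) (vertexFamily_M1At_pkg hLc hr cΛ j))
    (sep_add (N := Lc) (sep_vertex2OfK (N := Lc) hK hR2) (sep_add (N := Lc) (sep_mixOfK (N := Lc) hK hRM) (sep_mixOfK_swap (N := Lc) hK hRM)))

/-- [folklore] **THE DISPLAYED RESIDUAL IS ROW-PARITY-ODD** (every bond pair), for ANY weight kernel in the `dM` slot, once the rows of `R2` and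
`RM` are parity-odd (`SpineRecursivePureParity.parityOdd_dM_SpureRecAt_M1At` + `SecondOrderRemainderTables.parityOdd_slot₂`). -/
theorem parityOdd_Delta_literal₂ (hLc : 1 ≤ Lc) {r : Fin (d + 1) → ℕ} (hr : r ∈ box (d + 1) Lc) (cE cVH cΛ : ℝ) (j : ℕ)
    (Ξ : Fin (d + 1) → (Fin (d + 1) → ℤ) → MKer (d + 1) (Fib d))
    {R2 RM : Fin (d + 1) → (Fin (d + 1) → ℤ) → Fin (d + 1) → (Fin (d + 1) → ℤ) → MKer (d + 1) (Fib d)}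
    (hR2p : ∀ κ u κ' u', trK (R2 κ u κ' u') = -sgnK (R2 κ u κ' u')) (hRMp : ∀ κ u ρ w, trK (RM κ u ρ w) = -sgnK (RM κ u ρ w))
    (μ : Fin (d + 1)) (y : Fin (d + 1) → ℤ) (ν : Fin (d + 1)) (y' : Fin (d + 1) → ℤ) :
    trK (dM (Ξ ν y') Lc (SpureRecAt d Lc (toSite r) cE cVH cΛ j) (M1At d Lc (toSite r) cΛ j) μ y +
        (vertex2OfK (coDressKBmAt (toSite r) Lc (KInvStep (d := d) Lc j)) Lc R2 μ y ν y' +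
          (mixOfK (coDressKBmAt (toSite r) Lc (KInvStep (d := d) Lc j)) Lc RM μ y ν y' +
            mixOfK (coDressKBmAt (toSite r) Lc (KInvStep (d := d) Lc j)) Lc RM ν y' μ y))) =
      -sgnK (dM (Ξ ν y') Lc (SpureRecAt d Lc (toSite r) cE cVH cΛ j) (M1At d Lc (toSite r) cΛ j) μ y +
        (vertex2OfK (coDressKBmAt (toSite r) Lc (KInvStep (d := d) Lc j)) Lc R2 μ y ν y' +
          (mixOfK (coDressKBmAt (toSite r) Lc (KInvStep (d := d) Lc j)) Lc RM μ y ν y' +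
            mixOfK (coDressKBmAt (toSite r) Lc (KInvStep (d := d) Lc j)) Lc RM ν y' μ y))) :=
  parityOdd_add (parityOdd_dM_SpureRecAt_M1At hLc hr cE cVH cΛ cΛ j j (Ξ ν y') μ y)
    (parityOdd_slot₂ (N := Lc) (coDressKBmAt (toSite r) Lc (KInvStep (d := d) Lc j)) hR2p hRMp μ y ν y')

end Delta

/-! ## §3 The class step at the literal -/

section Step

variable {R2 RM RB : Fin (d + 1) → (Fin (d + 1) → ℤ) → Fin (d + 1) → (Fin (d + 1) → ℤ) → MKer (d + 1) (Fib d)}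
  {h h' : Fin (d + 1) → (Fin (d + 1) → ℤ) → Fin (d + 1) → (Fin (d + 1) → ℤ) → (Fin (d + 1) → ℤ) → Fib d → ℝ}

/-- [folklore] **THE CLASS STEP, LOCALISATION**: the owner's `hR2succ` right-hand side at the literal — with the displayed `X2s j α` and `Δ` of
`W2OfK_sharp_split_literal₂` substituted — is a `LocStencil₂` family at some rate, from the letter classes (`h` this level, `h′` next level, `RB`)
and the classes of `R2` (this level) and `RM`. -/
theorem locStencil₂_R2succ_literal (hLc : 1 ≤ Lc) {r : Fin (d + 1) → ℕ} (hr : r ∈ box (d + 1) Lc) (cE cVH cΛ : ℝ) (γ : ℕ → ℝ) (j : ℕ)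
    (α : Fin (d + 1)) (a w : ℝ)
    (hhl : ∃ Ch mh : ℝ, 0 < mh ∧ LocStencil₂ (fun κ u κ' u' => diagK (h κ u κ' u')) Ch mh)
    (hbl : ∃ Cb δb : ℝ, 0 < δb ∧ LocStencil₂ (fun κ u κ' u' => diagK (h' κ u κ' u')) Cb δb)
    (hBl : ∃ CB δB : ℝ, 0 < δB ∧ LocStencil₂ RB CB δB)
    (hR2 : ∃ C δ : ℝ, 0 < δ ∧ LocStencil₂ R2 C δ) (hRM : ∃ C δ : ℝ, 0 < δ ∧ LocStencilFM Lc RM C δ) :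
    ∃ C δ : ℝ, 0 < δ ∧ LocStencil₂ (fun κ u κ' u' =>
      -(a • mmRead Lc (comp (comp (coDressKBmAt (toSite r) Lc (KInvStep (d := d) Lc j))
          ((1 / 2 : ℝ) • conjV (bhKStepAt d (toSite r) Lc j) (diagK fun p e =>
              ((∑ κ₁, ∑' u₁, colH (coDressKBmAt (toSite r) Lc (KInvStep (d := d) Lc j)) Lc κ' u' κ₁ u₁ *
                    ∑ κ₂, ∑' u₂, colH (coDressKBmAt (toSite r) Lc (KInvStep (d := d) Lc j)) Lc κ u κ₂ u₂ * h κ₁ u₁ κ₂ u₂ p e) +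
                  ∑ κ₁, ∑' u₁, colH (K2OfK (coDressKBmAt (toSite r) Lc (KInvStep (d := d) Lc j)) Lc (SpureRecAt d Lc (toSite r) cE cVH cΛ j)
                      (M1At d Lc (toSite r) cΛ j) κ u +
                    (-(comp (comp (coDressKBmAt (toSite r) Lc (KInvStep (d := d) Lc j))
                        (conjV (bhKStepAt d (toSite r) Lc j)
                          (diagK fun p c => ∑ κ₃, ∑' u₃, colH (coDressKBmAt (toSite r) Lc (KInvStep (d := d) Lc j)) Lc κ u κ₃ u₃ * (γ j * ctGen d α Lc κ₃ u₃ p c))))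
                        (coDressKBmAt (toSite r) Lc (KInvStep (d := d) Lc j))))) Lc κ' u' κ₁ u₁ * (γ j * ctGen d α Lc κ₁ u₁ p e)) -
              ((∑ κ₁, ∑' u₁, colH (coDressKBmAt (toSite r) Lc (KInvStep (d := d) Lc j)) Lc κ u κ₁ u₁ *
                    ∑ κ₂, ∑' u₂, colH (coDressKBmAt (toSite r) Lc (KInvStep (d := d) Lc j)) Lc κ' u' κ₂ u₂ * h κ₁ u₁ κ₂ u₂ p e) +
                  ∑ κ₁, ∑' u₁, colH (K2OfK (coDressKBmAt (toSite r) Lc (KInvStep (d := d) Lc j)) Lc (SpureRecAt d Lc (toSite r) cE cVH cΛ j)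
                      (M1At d Lc (toSite r) cΛ j) κ' u' +
                    (-(comp (comp (coDressKBmAt (toSite r) Lc (KInvStep (d := d) Lc j))
                        (conjV (bhKStepAt d (toSite r) Lc j)
                          (diagK fun p c => ∑ κ₃, ∑' u₃, colH (coDressKBmAt (toSite r) Lc (KInvStep (d := d) Lc j)) Lc κ' u' κ₃ u₃ * (γ j * ctGen d α Lc κ₃ u₃ p c))))
                        (coDressKBmAt (toSite r) Lc (KInvStep (d := d) Lc j))))) Lc κ u κ₁ u₁ * (γ j * ctGen d α Lc κ₁ u₁ p e))) +
            (1 / 2 : ℝ) •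
              ((dM (-(comp (comp (coDressKBmAt (toSite r) Lc (KInvStep (d := d) Lc j))
                      (conjV (bhKStepAt d (toSite r) Lc j)
                        (diagK fun p c => ∑ κ₃, ∑' u₃, colH (coDressKBmAt (toSite r) Lc (KInvStep (d := d) Lc j)) Lc κ' u' κ₃ u₃ * (γ j * ctGen d α Lc κ₃ u₃ p c))))
                      (coDressKBmAt (toSite r) Lc (KInvStep (d := d) Lc j))))
                  Lc (SpureRecAt d Lc (toSite r) cE cVH cΛ j) (M1At d Lc (toSite r) cΛ j) κ u +
                (vertex2OfK (coDressKBmAt (toSite r) Lc (KInvStep (d := d) Lc j)) Lc R2 κ u κ' u' +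
                  (mixOfK (coDressKBmAt (toSite r) Lc (KInvStep (d := d) Lc j)) Lc RM κ u κ' u' +
                    mixOfK (coDressKBmAt (toSite r) Lc (KInvStep (d := d) Lc j)) Lc RM κ' u' κ u))) +
              (dM (-(comp (comp (coDressKBmAt (toSite r) Lc (KInvStep (d := d) Lc j))
                      (conjV (bhKStepAt d (toSite r) Lc j)
                        (diagK fun p c => ∑ κ₃, ∑' u₃, colH (coDressKBmAt (toSite r) Lc (KInvStep (d := d) Lc j)) Lc κ u κ₃ u₃ * (γ j * ctGen d α Lc κ₃ u₃ p c))))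
                      (coDressKBmAt (toSite r) Lc (KInvStep (d := d) Lc j))))
                  Lc (SpureRecAt d Lc (toSite r) cE cVH cΛ j) (M1At d Lc (toSite r) cΛ j) κ' u' +
                (vertex2OfK (coDressKBmAt (toSite r) Lc (KInvStep (d := d) Lc j)) Lc R2 κ' u' κ u +
                  (mixOfK (coDressKBmAt (toSite r) Lc (KInvStep (d := d) Lc j)) Lc RM κ' u' κ u +
                    mixOfK (coDressKBmAt (toSite r) Lc (KInvStep (d := d) Lc j)) Lc RM κ u κ' u'))))))
          (coDressKBmAt (toSite r) Lc (KInvStep (d := d) Lc j)))) + RB κ u κ' u' +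
        conjV (mmRead Lc (coDressKBmAt (toSite r) Lc (KInvStep (d := d) Lc j)))
          (diagK fun p c => a * mmSym Lc (fun p e =>
              (∑ κ₁, ∑' u₁, colH (coDressKBmAt (toSite r) Lc (KInvStep (d := d) Lc j)) Lc κ u κ₁ u₁ *
                    ∑ κ₂, ∑' u₂, colH (coDressKBmAt (toSite r) Lc (KInvStep (d := d) Lc j)) Lc κ' u' κ₂ u₂ * h κ₁ u₁ κ₂ u₂ p e) +
                  ∑ κ₁, ∑' u₁, colH (K2OfK (coDressKBmAt (toSite r) Lc (KInvStep (d := d) Lc j)) Lc (SpureRecAt d Lc (toSite r) cE cVH cΛ j)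
                      (M1At d Lc (toSite r) cΛ j) κ' u' +
                    (-(comp (comp (coDressKBmAt (toSite r) Lc (KInvStep (d := d) Lc j))
                        (conjV (bhKStepAt d (toSite r) Lc j)
                          (diagK fun p c => ∑ κ₃, ∑' u₃, colH (coDressKBmAt (toSite r) Lc (KInvStep (d := d) Lc j)) Lc κ' u' κ₃ u₃ * (γ j * ctGen d α Lc κ₃ u₃ p c))))
                        (coDressKBmAt (toSite r) Lc (KInvStep (d := d) Lc j))))) Lc κ u κ₁ u₁ * (γ j * ctGen d α Lc κ₁ u₁ p e)) p c -
            w * h' κ u κ' u' p c)) C δ :=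
  locStencil₂_R2succ hLc hr j a w
    (X2s := fun μ y ν y' p e =>
      (∑ κ₁, ∑' u₁, colH (coDressKBmAt (toSite r) Lc (KInvStep (d := d) Lc j)) Lc μ y κ₁ u₁ *
          ∑ κ₂, ∑' u₂, colH (coDressKBmAt (toSite r) Lc (KInvStep (d := d) Lc j)) Lc ν y' κ₂ u₂ * h κ₁ u₁ κ₂ u₂ p e) +
        ∑ κ₁, ∑' u₁, colH (K2OfK (coDressKBmAt (toSite r) Lc (KInvStep (d := d) Lc j)) Lc (SpureRecAt d Lc (toSite r) cE cVH cΛ j)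
            (M1At d Lc (toSite r) cΛ j) ν y' +
          (-(comp (comp (coDressKBmAt (toSite r) Lc (KInvStep (d := d) Lc j))
              (conjV (bhKStepAt d (toSite r) Lc j)
                (diagK fun p c => ∑ κ₃, ∑' u₃, colH (coDressKBmAt (toSite r) Lc (KInvStep (d := d) Lc j)) Lc ν y' κ₃ u₃ * (γ j * ctGen d α Lc κ₃ u₃ p c))))
              (coDressKBmAt (toSite r) Lc (KInvStep (d := d) Lc j))))) Lc μ y κ₁ u₁ * (γ j * ctGen d α Lc κ₁ u₁ p e))
    (Δ := fun μ y ν y' =>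
      dM (-(comp (comp (coDressKBmAt (toSite r) Lc (KInvStep (d := d) Lc j))
            (conjV (bhKStepAt d (toSite r) Lc j)
              (diagK fun p c => ∑ κ₃, ∑' u₃, colH (coDressKBmAt (toSite r) Lc (KInvStep (d := d) Lc j)) Lc ν y' κ₃ u₃ * (γ j * ctGen d α Lc κ₃ u₃ p c))))
            (coDressKBmAt (toSite r) Lc (KInvStep (d := d) Lc j))))
        Lc (SpureRecAt d Lc (toSite r) cE cVH cΛ j) (M1At d Lc (toSite r) cΛ j) μ y +
      (vertex2OfK (coDressKBmAt (toSite r) Lc (KInvStep (d := d) Lc j)) Lc R2 μ y ν y' +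
        (mixOfK (coDressKBmAt (toSite r) Lc (KInvStep (d := d) Lc j)) Lc RM μ y ν y' +
          mixOfK (coDressKBmAt (toSite r) Lc (KInvStep (d := d) Lc j)) Lc RM ν y' μ y)))
    (sep_X2s_literal hLc hr cE cVH cΛ γ j α hhl) (sep_Delta_literal₂ hLc hr cE cVH cΛ γ j α hR2 hRM) hBl hbl

/-- [folklore] **THE CLASS STEP, PARITY**: the same right-hand side has parity-odd rows, from the row parities of `R2`, `RM` (this level) and of
`RB`, and the separation data (needed only to localise the sandwiched residual). -/
theorem parityOdd_R2succ_literal (hLc : 1 ≤ Lc) {r : Fin (d + 1) → ℕ} (hr : r ∈ box (d + 1) Lc) (cE cVH cΛ : ℝ) (γ : ℕ → ℝ) (j : ℕ)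
    (α : Fin (d + 1)) (a w : ℝ)
    (hhl : ∃ Ch mh : ℝ, 0 < mh ∧ LocStencil₂ (fun κ u κ' u' => diagK (h κ u κ' u')) Ch mh)
    (hR2 : ∃ C δ : ℝ, 0 < δ ∧ LocStencil₂ R2 C δ) (hRM : ∃ C δ : ℝ, 0 < δ ∧ LocStencilFM Lc RM C δ)
    (hR2p : ∀ κ u κ' u', trK (R2 κ u κ' u') = -sgnK (R2 κ u κ' u')) (hRMp : ∀ κ u ρ w, trK (RM κ u ρ w) = -sgnK (RM κ u ρ w))
    (hBp : ∀ κ u κ' u', trK (RB κ u κ' u') = -sgnK (RB κ u κ' u'))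
    (κ : Fin (d + 1)) (u : Fin (d + 1) → ℤ) (κ' : Fin (d + 1)) (u' : Fin (d + 1) → ℤ) :
    trK (-(a • mmRead Lc (comp (comp (coDressKBmAt (toSite r) Lc (KInvStep (d := d) Lc j)) ((1 / 2 : ℝ) • conjV (bhKStepAt d (toSite r) Lc j) (diagK fun p a => (fun p e => (∑ κ₁, ∑' u₁, colH (coDressKBmAt (toSite r) Lc (KInvStep (d := d) Lc j)) Lc κ' u' κ₁ u₁ * ∑ κ₂, ∑' u₂, colH (coDressKBmAt (toSite r) Lc (KInvStep (d := d) Lc j)) Lc κ u κ₂ u₂ * h κ₁ u₁ κ₂ u₂ p e) + ∑ κ₁, ∑' u₁, colH (K2OfK (coDressKBmAt (toSite r) Lc (KInvStep (d := d) Lc j)) Lc (SpureRecAt d Lc (toSite r) cE cVH cΛ j) (M1At d Lc (toSite r) cΛ j) κ u + (-(comp (comp (coDressKBmAt (toSite r) Lc (KInvStep (d := d) Lc j)) (conjV (bhKStepAt d (toSite r) Lc j) (diagK fun p c => ∑ κ₃, ∑' u₃, colH (coDressKBmAt (toSite r) Lc (KInvStep (d := d) Lc j)) Lc κ u κ₃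 u₃ * (γ j * ctGen d α Lc κ₃ u₃ p c)))) (coDressKBmAt (toSite r) Lc (KInvStep (d := d) Lc j))))) Lc κ' u' κ₁ u₁ * (γ j * ctGen d α Lc κ₁ u₁ p e)) p a - (fun p e => (∑ κ₁, ∑' u₁, colH (coDressKBmAt (toSite r) Lc (KInvStep (d := d) Lc j)) Lc κ u κ₁ u₁ * ∑ κ₂, ∑' u₂, colH (coDressKBmAt (toSite r) Lc (KInvStep (d := d) Lc j)) Lc κ' u' κ₂ u₂ * h κ₁ u₁ κ₂ u₂ p e) + ∑ κ₁, ∑' u₁, colH (K2OfK (coDressKBmAt (toSite r) Lc (KInvStep (d := d) Lc j)) Lc (SpureRecAt d Lc (toSite r) cE cVH cΛ j) (M1At d Lc (toSite r) cΛ j) κ' u' + (-(comp (comp (coDressKBmAt (toSite r) Lc (KInvStep (d := d) Lc j)) (conjV (bhKStepAt d (toSite r) Lc j) (diagK fun p c => ∑ κ₃, ∑' u₃, colH (coDressKBmAt (toSite r) Lc (KInvStep (d := d) Lc j)) Lc κ' u' κ₃ u₃ * (γ j * ctGen d α Lc κ₃ u₃ p c)))) (coDressKBmAt (toSite r) Lc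 (KInvStep (d := d) Lc j))))) Lc κ u κ₁ u₁ * (γ j * ctGen d α Lc κ₁ u₁ p e)) p a) + (1 / 2 : ℝ) • ((dM (-(comp (comp (coDressKBmAt (toSite r) Lc (KInvStep (d := d) Lc j)) (conjV (bhKStepAt d (toSite r) Lc j) (diagK fun p c => ∑ κ₃, ∑' u₃, colH (coDressKBmAt (toSite r) Lc (KInvStep (d := d) Lc j)) Lc κ' u' κ₃ u₃ * (γ j * ctGen d α Lc κ₃ u₃ p c)))) (coDressKBmAt (toSite r) Lc (KInvStep (d := d) Lc j)))) Lc (SpureRecAt d Lc (toSite r) cE cVH cΛ j) (M1At d Lc (toSite r) cΛ j) κ u + (vertex2OfK (coDressKBmAt (toSite r) Lc (KInvStep (d := d) Lc j)) Lc R2 κ u κ' u' + (mixOfK (coDressKBmAt (toSite r) Lc (KInvStep (d := d) Lc j)) Lc RM κ u κ' u' + mixOfK (coDressKBmAt (toSite r) Lc (KInvStep (d := d) Lc j)) Lc RM κ' u' κ u))) + (dM (-(comp (comp (coDressKBmAt (toSite r) Lc (KInvStep (d := d) Lc j)) (conjV (bhKStepAt d (toSite r) Lc j) (diagK fun p c =>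 ∑ κ₃, ∑' u₃, colH (coDressKBmAt (toSite r) Lc (KInvStep (d := d) Lc j)) Lc κ u κ₃ u₃ * (γ j * ctGen d α Lc κ₃ u₃ p c)))) (coDressKBmAt (toSite r) Lc (KInvStep (d := d) Lc j)))) Lc (SpureRecAt d Lc (toSite r) cE cVH cΛ j) (M1At d Lc (toSite r) cΛ j) κ' u' + (vertex2OfK (coDressKBmAt (toSite r) Lc (KInvStep (d := d) Lc j)) Lc R2 κ' u' κ u + (mixOfK (coDressKBmAt (toSite r) Lc (KInvStep (d := d) Lc j)) Lc RM κ' u' κ u + mixOfK (coDressKBmAt (toSite r) Lc (KInvStep (d := d) Lc j)) Lc RM κ u κ' u')))))) (coDressKBmAt (toSite r) Lc (KInvStep (d := d) Lc j)))) + RB κ u κ' u' + conjV (mmRead Lc (coDressKBmAt (toSite r) Lc (KInvStep (d := d) Lc j))) (diagK fun p c => a * mmSym Lc (fun p e => (∑ κ₁, ∑' u₁, colH (coDressKBmAt (toSite r) Lc (KInvStep (d := d) Lc j)) Lc κ u κ₁ u₁ * ∑ κ₂, ∑' u₂, colH (coDressKBmAt (toSite r) Lc (KInvStep (d := d) Lc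 j)) Lc κ' u' κ₂ u₂ * h κ₁ u₁ κ₂ u₂ p e) + ∑ κ₁, ∑' u₁, colH (K2OfK (coDressKBmAt (toSite r) Lc (KInvStep (d := d) Lc j)) Lc (SpureRecAt d Lc (toSite r) cE cVH cΛ j) (M1At d Lc (toSite r) cΛ j) κ' u' + (-(comp (comp (coDressKBmAt (toSite r) Lc (KInvStep (d := d) Lc j)) (conjV (bhKStepAt d (toSite r) Lc j) (diagK fun p c => ∑ κ₃, ∑' u₃, colH (coDressKBmAt (toSite r) Lc (KInvStep (d := d) Lc j)) Lc κ' u' κ₃ u₃ * (γ j * ctGen d α Lc κ₃ u₃ p c)))) (coDressKBmAt (toSite r) Lc (KInvStep (d := d) Lc j))))) Lc κ u κ₁ u₁ * (γ j * ctGen d α Lc κ₁ u₁ p e)) p c - w * h' κ u κ' u' p c)) =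
      -sgnK (-(a • mmRead Lc (comp (comp (coDressKBmAt (toSite r) Lc (KInvStep (d := d) Lc j)) ((1 / 2 : ℝ) • conjV (bhKStepAt d (toSite r) Lc j) (diagK fun p a => (fun p e => (∑ κ₁, ∑' u₁, colH (coDressKBmAt (toSite r) Lc (KInvStep (d := d) Lc j)) Lc κ' u' κ₁ u₁ * ∑ κ₂, ∑' u₂, colH (coDressKBmAt (toSite r) Lc (KInvStep (d := d) Lc j)) Lc κ u κ₂ u₂ * h κ₁ u₁ κ₂ u₂ p e) + ∑ κ₁, ∑' u₁, colH (K2OfK (coDressKBmAt (toSite r) Lc (KInvStep (d := d) Lc j)) Lc (SpureRecAt d Lc (toSite r) cE cVH cΛ j) (M1At d Lc (toSite r) cΛ j) κ u + (-(comp (comp (coDressKBmAt (toSite r) Lc (KInvStep (d := d) Lc j)) (conjV (bhKStepAt d (toSite r) Lc j) (diagK fun p c => ∑ κ₃, ∑' u₃, colH (coDressKBmAt (toSite r) Lc (KInvStep (d := d) Lc j)) Lc κ u κ₃ u₃ * (γ j * ctGen d α Lc κ₃ u₃ p c)))) (coDressKBmAt (toSite r) Lc (KInvStep (d := d) Lc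 j))))) Lc κ' u' κ₁ u₁ * (γ j * ctGen d α Lc κ₁ u₁ p e)) p a - (fun p e => (∑ κ₁, ∑' u₁, colH (coDressKBmAt (toSite r) Lc (KInvStep (d := d) Lc j)) Lc κ u κ₁ u₁ * ∑ κ₂, ∑' u₂, colH (coDressKBmAt (toSite r) Lc (KInvStep (d := d) Lc j)) Lc κ' u' κ₂ u₂ * h κ₁ u₁ κ₂ u₂ p e) + ∑ κ₁, ∑' u₁, colH (K2OfK (coDressKBmAt (toSite r) Lc (KInvStep (d := d) Lc j)) Lc (SpureRecAt d Lc (toSite r) cE cVH cΛ j) (M1At d Lc (toSite r) cΛ j) κ' u' + (-(comp (comp (coDressKBmAt (toSite r) Lc (KInvStep (d := d) Lc j)) (conjV (bhKStepAt d (toSite r) Lc j) (diagK fun p c => ∑ κ₃, ∑' u₃, colH (coDressKBmAt (toSite r) Lc (KInvStep (d := d) Lc j)) Lc κ' u' κ₃ u₃ * (γ j * ctGen d α Lc κ₃ u₃ p c)))) (coDressKBmAt (toSite r) Lc (KInvStep (d := d) Lc j))))) Lc κ u κ₁ u₁ * (γ j * ctGen d α Lc κ₁ u₁ p e)) p a)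 + (1 / 2 : ℝ) • ((dM (-(comp (comp (coDressKBmAt (toSite r) Lc (KInvStep (d := d) Lc j)) (conjV (bhKStepAt d (toSite r) Lc j) (diagK fun p c => ∑ κ₃, ∑' u₃, colH (coDressKBmAt (toSite r) Lc (KInvStep (d := d) Lc j)) Lc κ' u' κ₃ u₃ * (γ j * ctGen d α Lc κ₃ u₃ p c)))) (coDressKBmAt (toSite r) Lc (KInvStep (d := d) Lc j)))) Lc (SpureRecAt d Lc (toSite r) cE cVH cΛ j) (M1At d Lc (toSite r) cΛ j) κ u + (vertex2OfK (coDressKBmAt (toSite r) Lc (KInvStep (d := d) Lc j)) Lc R2 κ u κ' u' + (mixOfK (coDressKBmAt (toSite r) Lc (KInvStep (d := d) Lc j)) Lc RM κ u κ' u' + mixOfK (coDressKBmAt (toSite r) Lc (KInvStep (d := d) Lc j)) Lc RM κ' u' κ u))) + (dM (-(comp (comp (coDressKBmAt (toSite r) Lc (KInvStep (d := d) Lc j)) (conjV (bhKStepAt d (toSite r) Lc j) (diagK fun p c => ∑ κ₃, ∑' u₃, colH (coDressKBmAt (toSite r) Lc (KInvStep (d := d) Lc j)) Lc κ u κ₃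 u₃ * (γ j * ctGen d α Lc κ₃ u₃ p c)))) (coDressKBmAt (toSite r) Lc (KInvStep (d := d) Lc j)))) Lc (SpureRecAt d Lc (toSite r) cE cVH cΛ j) (M1At d Lc (toSite r) cΛ j) κ' u' + (vertex2OfK (coDressKBmAt (toSite r) Lc (KInvStep (d := d) Lc j)) Lc R2 κ' u' κ u + (mixOfK (coDressKBmAt (toSite r) Lc (KInvStep (d := d) Lc j)) Lc RM κ' u' κ u + mixOfK (coDressKBmAt (toSite r) Lc (KInvStep (d := d) Lc j)) Lc RM κ u κ' u')))))) (coDressKBmAt (toSite r) Lc (KInvStep (d := d) Lc j)))) + RB κ u κ' u' + conjV (mmRead Lc (coDressKBmAt (toSite r) Lc (KInvStep (d := d) Lc j))) (diagK fun p c => a * mmSym Lc (fun p e => (∑ κ₁, ∑' u₁, colH (coDressKBmAt (toSite r) Lc (KInvStep (d := d) Lc j)) Lc κ u κ₁ u₁ * ∑ κ₂, ∑' u₂, colH (coDressKBmAt (toSite r) Lc (KInvStep (d := d) Lc j)) Lc κ' u' κ₂ u₂ * h κ₁ u₁ κ₂ u₂ p e) + ∑ κ₁, ∑' u₁, colH (K2OfK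 (coDressKBmAt (toSite r) Lc (KInvStep (d := d) Lc j)) Lc (SpureRecAt d Lc (toSite r) cE cVH cΛ j) (M1At d Lc (toSite r) cΛ j) κ' u' + (-(comp (comp (coDressKBmAt (toSite r) Lc (KInvStep (d := d) Lc j)) (conjV (bhKStepAt d (toSite r) Lc j) (diagK fun p c => ∑ κ₃, ∑' u₃, colH (coDressKBmAt (toSite r) Lc (KInvStep (d := d) Lc j)) Lc κ' u' κ₃ u₃ * (γ j * ctGen d α Lc κ₃ u₃ p c)))) (coDressKBmAt (toSite r) Lc (KInvStep (d := d) Lc j))))) Lc κ u κ₁ u₁ * (γ j * ctGen d α Lc κ₁ u₁ p e)) p c - w * h' κ u κ' u' p c)) :=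
  parityOdd_R2succ hLc hr j a w
    (X2s := fun μ y ν y' => (fun p e => (∑ κ₁, ∑' u₁, colH (coDressKBmAt (toSite r) Lc (KInvStep (d := d) Lc j)) Lc μ y κ₁ u₁ * ∑ κ₂, ∑' u₂, colH (coDressKBmAt (toSite r) Lc (KInvStep (d := d) Lc j)) Lc ν y' κ₂ u₂ * h κ₁ u₁ κ₂ u₂ p e) + ∑ κ₁, ∑' u₁, colH (K2OfK (coDressKBmAt (toSite r) Lc (KInvStep (d := d) Lc j)) Lc (SpureRecAt d Lc (toSite r) cE cVH cΛ j) (M1At d Lc (toSite r) cΛ j) ν y' + (-(comp (comp (coDressKBmAt (toSite r) Lc (KInvStep (d := d) Lc j)) (conjV (bhKStepAt d (toSite r) Lc j) (diagK fun p c => ∑ κ₃, ∑' u₃, colH (coDressKBmAt (toSite r) Lc (KInvStep (d := d) Lc j)) Lc ν y' κ₃ u₃ * (γ j * ctGen d α Lc κ₃ u₃ p c)))) (coDressKBmAt (toSite r) Lc (KInvStep (d := d) Lc j))))) Lc μ y κ₁ u₁ * (γ j * ctGen d α Lc κ₁ u₁ p e)))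
    (Δ := fun μ y ν y' => (dM (-(comp (comp (coDressKBmAt (toSite r) Lc (KInvStep (d := d) Lc j)) (conjV (bhKStepAt d (toSite r) Lc j) (diagK fun p c => ∑ κ₃, ∑' u₃, colH (coDressKBmAt (toSite r) Lc (KInvStep (d := d) Lc j)) Lc ν y' κ₃ u₃ * (γ j * ctGen d α Lc κ₃ u₃ p c)))) (coDressKBmAt (toSite r) Lc (KInvStep (d := d) Lc j)))) Lc (SpureRecAt d Lc (toSite r) cE cVH cΛ j) (M1At d Lc (toSite r) cΛ j) μ y + (vertex2OfK (coDressKBmAt (toSite r) Lc (KInvStep (d := d) Lc j)) Lc R2 μ y ν y' + (mixOfK (coDressKBmAt (toSite r) Lc (KInvStep (d := d) Lc j)) Lc RM μ y ν y' + mixOfK (coDressKBmAt (toSite r) Lc (KInvStep (d := d) Lc j)) Lc RM ν y' μ y))))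
    (sep_X2s_literal hLc hr cE cVH cΛ γ j α hhl) (sep_Delta_literal₂ hLc hr cE cVH cΛ γ j α hR2 hRM)
    (fun μ y ν y' => parityOdd_Delta_literal₂ hLc hr cE cVH cΛ j (fun ν y' => (-(comp (comp (coDressKBmAt (toSite r) Lc (KInvStep (d := d) Lc j)) (conjV (bhKStepAt d (toSite r) Lc j) (diagK fun p c => ∑ κ₃, ∑' u₃, colH (coDressKBmAt (toSite r) Lc (KInvStep (d := d) Lc j)) Lc ν y' κ₃ u₃ * (γ j * ctGen d α Lc κ₃ u₃ p c)))) (coDressKBmAt (toSite r) Lc (KInvStep (d := d) Lc j))))) hR2p hRMp μ y ν y') hBp κ u κ' u'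

end Step

/-! ## §4 The class at every level -/

section All

/-- [folklore] **THE REMAINDER CLASS AT EVERY LEVEL**: if `R2 0 α` is `LocStencil₂` with parity-odd rows (the level-0 letter), the mixed remainders
`RM j α` and the border remainders `RB j α` are (their letters), every symbol `h j α` carries its `LocStencil₂` class, and `R2` obeys the owner's
recursion `hR2succ` with the DISPLAYED `X2s j α`∕`Δ j α` of `SecondOrderSplitLiteral.W2OfK_sharp_split_literal₂` (any coefficients `a j`, `w j`),
then EVERY `R2 j α` is `LocStencil₂` at some rate with parity-odd rows. -/
theorem class_R2_all (hLc : 1 ≤ Lc) {r : Fin (d + 1) → ℕ} (hr : r ∈ box (d + 1) Lc) (cE cVH cΛ : ℝ) (γ : ℕ → ℝ) (a w : ℕ → ℝ)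
    (h : ℕ → Fin (d + 1) → Fin (d + 1) → (Fin (d + 1) → ℤ) → Fin (d + 1) → (Fin (d + 1) → ℤ) → (Fin (d + 1) → ℤ) → Fib d → ℝ)
    (hhl : ∀ j α, ∃ Ch mh : ℝ, 0 < mh ∧ LocStencil₂ (fun κ u κ' u' => diagK (h j α κ u κ' u')) Ch mh)
    (RM RB R2 : ℕ → Fin (d + 1) → Fin (d + 1) → (Fin (d + 1) → ℤ) → Fin (d + 1) → (Fin (d + 1) → ℤ) → MKer (d + 1) (Fib d))
    (hRM : ∀ j α, ∃ C δ : ℝ, 0 < δ ∧ LocStencilFM Lc (RM j α) C δ) (hRMp : ∀ j α κ u ρ w, trK (RM j α κ u ρ w) = -sgnK (RM j α κ u ρ w))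
    (hBl : ∀ j α, ∃ C δ : ℝ, 0 < δ ∧ LocStencil₂ (RB j α) C δ) (hBp : ∀ j α κ u κ' u', trK (RB j α κ u κ' u') = -sgnK (RB j α κ u κ' u'))
    (h0l : ∀ α, ∃ C δ : ℝ, 0 < δ ∧ LocStencil₂ (R2 0 α) C δ) (h0p : ∀ α κ u κ' u', trK (R2 0 α κ u κ' u') = -sgnK (R2 0 α κ u κ' u'))
    (hR2succ : ∀ (j : ℕ) (α κ : Fin (d + 1)) (u : Fin (d + 1) → ℤ) (κ' : Fin (d + 1)) (u' : Fin (d + 1) → ℤ),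
      R2 (j + 1) α κ u κ' u' = -(a j • mmRead Lc (comp (comp (coDressKBmAt (toSite r) Lc (KInvStep (d := d) Lc j)) ((1 / 2 : ℝ) • conjV (bhKStepAt d (toSite r) Lc j) (diagK fun p a => (fun p e => (∑ κ₁, ∑' u₁, colH (coDressKBmAt (toSite r) Lc (KInvStep (d := d) Lc j)) Lc κ' u' κ₁ u₁ * ∑ κ₂, ∑' u₂, colH (coDressKBmAt (toSite r) Lc (KInvStep (d := d) Lc j)) Lc κ u κ₂ u₂ * h j α κ₁ u₁ κ₂ u₂ p e) + ∑ κ₁, ∑' u₁, colH (K2OfK (coDressKBmAt (toSite r) Lc (KInvStep (d := d) Lc j)) Lc (SpureRecAt d Lc (toSite r) cE cVH cΛ j) (M1At d Lc (toSite r) cΛ j) κ u + (-(comp (comp (coDressKBmAt (toSite r) Lc (KInvStep (d := d) Lc j)) (conjV (bhKStepAt d (toSite r) Lc j) (diagK fun p c => ∑ κ₃, ∑' u₃, colH (coDressKBmAt (toSite r) Lc (KInvStep (d := d) Lc j)) Lc κ u κ₃ u₃ * (γ j * ctGen d α Lc κ₃ u₃ p c)))) (coDressKBmAt (toSite r) Lc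 (KInvStep (d := d) Lc j))))) Lc κ' u' κ₁ u₁ * (γ j * ctGen d α Lc κ₁ u₁ p e)) p a - (fun p e => (∑ κ₁, ∑' u₁, colH (coDressKBmAt (toSite r) Lc (KInvStep (d := d) Lc j)) Lc κ u κ₁ u₁ * ∑ κ₂, ∑' u₂, colH (coDressKBmAt (toSite r) Lc (KInvStep (d := d) Lc j)) Lc κ' u' κ₂ u₂ * h j α κ₁ u₁ κ₂ u₂ p e) + ∑ κ₁, ∑' u₁, colH (K2OfK (coDressKBmAt (toSite r) Lc (KInvStep (d := d) Lc j)) Lc (SpureRecAt d Lc (toSite r) cE cVH cΛ j) (M1At d Lc (toSite r) cΛ j) κ' u' + (-(comp (comp (coDressKBmAt (toSite r) Lc (KInvStep (d := d) Lc j)) (conjV (bhKStepAt d (toSite r) Lc j) (diagK fun p c => ∑ κ₃, ∑' u₃, colH (coDressKBmAt (toSite r) Lc (KInvStep (d := d) Lc j)) Lc κ' u' κ₃ u₃ * (γ j * ctGen d α Lc κ₃ u₃ p c)))) (coDressKBmAt (toSite r) Lc (KInvStep (d := d) Lc j))))) Lc κ u κ₁ u₁ * (γ j * ctGen d α Lc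 κ₁ u₁ p e)) p a) + (1 / 2 : ℝ) • ((dM (-(comp (comp (coDressKBmAt (toSite r) Lc (KInvStep (d := d) Lc j)) (conjV (bhKStepAt d (toSite r) Lc j) (diagK fun p c => ∑ κ₃, ∑' u₃, colH (coDressKBmAt (toSite r) Lc (KInvStep (d := d) Lc j)) Lc κ' u' κ₃ u₃ * (γ j * ctGen d α Lc κ₃ u₃ p c)))) (coDressKBmAt (toSite r) Lc (KInvStep (d := d) Lc j)))) Lc (SpureRecAt d Lc (toSite r) cE cVH cΛ j) (M1At d Lc (toSite r) cΛ j) κ u + (vertex2OfK (coDressKBmAt (toSite r) Lc (KInvStep (d := d) Lc j)) Lc (R2 j α) κ u κ' u' + (mixOfK (coDressKBmAt (toSite r) Lc (KInvStep (d := d) Lc j)) Lc (RM j α) κ u κ' u' + mixOfK (coDressKBmAt (toSite r) Lc (KInvStep (d := d) Lc j)) Lc (RM j α) κ' u' κ u))) + (dM (-(comp (comp (coDressKBmAt (toSite r) Lc (KInvStep (d := d) Lc j)) (conjV (bhKStepAt d (toSite r) Lc j) (diagK fun p c => ∑ κ₃, ∑' u₃, colH (coDressKBmAt (toSite r) Lc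 (KInvStep (d := d) Lc j)) Lc κ u κ₃ u₃ * (γ j * ctGen d α Lc κ₃ u₃ p c)))) (coDressKBmAt (toSite r) Lc (KInvStep (d := d) Lc j)))) Lc (SpureRecAt d Lc (toSite r) cE cVH cΛ j) (M1At d Lc (toSite r) cΛ j) κ' u' + (vertex2OfK (coDressKBmAt (toSite r) Lc (KInvStep (d := d) Lc j)) Lc (R2 j α) κ' u' κ u + (mixOfK (coDressKBmAt (toSite r) Lc (KInvStep (d := d) Lc j)) Lc (RM j α) κ' u' κ u + mixOfK (coDressKBmAt (toSite r) Lc (KInvStep (d := d) Lc j)) Lc (RM j α) κ u κ' u')))))) (coDressKBmAt (toSite r) Lc (KInvStep (d := d) Lc j)))) + (RB (j + 1) α) κ u κ' u' + conjV (mmRead Lc (coDressKBmAt (toSite r) Lc (KInvStep (d := d) Lc j))) (diagK fun p c => a j * mmSym Lc (fun p e => (∑ κ₁, ∑' u₁, colH (coDressKBmAt (toSite r) Lc (KInvStep (d := d) Lc j)) Lc κ u κ₁ u₁ * ∑ κ₂, ∑' u₂, colH (coDressKBmAt (toSite r) Lc (KInvStep (d := d) Lc j)) Lc κ' u' κ₂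 u₂ * h j α κ₁ u₁ κ₂ u₂ p e) + ∑ κ₁, ∑' u₁, colH (K2OfK (coDressKBmAt (toSite r) Lc (KInvStep (d := d) Lc j)) Lc (SpureRecAt d Lc (toSite r) cE cVH cΛ j) (M1At d Lc (toSite r) cΛ j) κ' u' + (-(comp (comp (coDressKBmAt (toSite r) Lc (KInvStep (d := d) Lc j)) (conjV (bhKStepAt d (toSite r) Lc j) (diagK fun p c => ∑ κ₃, ∑' u₃, colH (coDressKBmAt (toSite r) Lc (KInvStep (d := d) Lc j)) Lc κ' u' κ₃ u₃ * (γ j * ctGen d α Lc κ₃ u₃ p c)))) (coDressKBmAt (toSite r) Lc (KInvStep (d := d) Lc j))))) Lc κ u κ₁ u₁ * (γ j * ctGen d α Lc κ₁ u₁ p e)) p c - w j * h (j + 1) α κ u κ' u' p c)) :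
    ∀ (j : ℕ) (α : Fin (d + 1)), (∃ C δ : ℝ, 0 < δ ∧ LocStencil₂ (R2 j α) C δ) ∧
      (∀ κ u κ' u', trK (R2 j α κ u κ' u') = -sgnK (R2 j α κ u κ' u')) := by
  intro j
  induction j with
  | zero => exact fun α => ⟨h0l α, h0p α⟩
  | succ j ih =>
    intro α
    obtain ⟨C, δ, hδ, hL⟩ := locStencil₂_R2succ_literal (R2 := R2 j α) (RM := RM j α) (RB := RB (j + 1) α) (h := h j α) (h' := h (j + 1) α)
      hLc hr cE cVH cΛ γ j α (a j) (w j) (hhl j α) (hhl (j + 1) α) (hBl (j + 1) α) (ih α).1 (hRM j α)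
    refine ⟨⟨C, δ, hδ, fun κ u κ' u' => ?_⟩, fun κ u κ' u' => ?_⟩
    · rw [hR2succ]; exact hL κ u κ' u'
    · rw [hR2succ]
      exact parityOdd_R2succ_literal (R2 := R2 j α) (RM := RM j α) (RB := RB (j + 1) α) (h := h j α) (h' := h (j + 1) α)
        hLc hr cE cVH cΛ γ j α (a j) (w j) (hhl j α) (ih α).1 (hRM j α) (ih α).2 (hRMp j α) (hBp (j + 1) α) κ u κ' u'

end All

end Summit.QuantumFields.BalabanUV.Beta.SecondOrderClassLiteral

end
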